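import Mathlib.LinearAlgebra.Vandermonde
import Mathlib.LinearAlgebra.Matrix.NonsingularInverse
import Mathlib.LinearAlgebra.Matrix.Block
import Mathlib.Analysis.SpecialFunctions.Exp
import Mathlib.Topology.Instances.Matrix
import Literature.Analysis.TotalPositivity.PolyaFrequencyRecognition
import Literature.Analysis.TotalPositivity.FeketeCriterion
import Literature.Analysis.TotalPositivity.MultiplyPositiveProofs
import HarnessLib

/-!
# Ando's recognition theorem for invertible (lower triangular) matrices — proved

Trunk T-ANALYSIS (Literature/Analysis/TotalPositivity). Part 5 of the decomposition of the named
fact `Literature.Analysis.TotalPositivity.aswe_edrei` (PolyaFrequency.lean): we DISCHARGE the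
named fact `ando1987_lowerTriangular_tn` (PolyaFrequencyRecognition.lean) = [Ando1987, Cor. 2.2]
= [FallatJohnson2011, Lemma 3.3.4]: an invertible lower triangular real matrix all of whose
minors with initial columns are `≥ 0` is totally nonnegative. Consequently the recognition
theorem `IsColumnPF.isPolyaFrequencySeq` (column-positive + `b₀ > 0` ⇒ PF), the pole-stripping
step `IsPolyaFrequencySeq.mulLinear_neg_ratioLimit` and everything downstream
(`asw1952_representation`, ASWMeromorphic.lean) become unconditional.

## The proof

Two steps, both printed in [FallatJohnson2011, §3.3].

* **Invertible + consecutive-column minors `≥ 0` ⇒ TN** (`det_submatrix_nonneg_of_isConsec`;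
  [FallatJohnson2011, Thm. 3.3.2] in rank `r = n`, = [Ando1987, Thm. 2.1] = Cryer 1976, Thm. 1.3).
  Instead of the printed induction (Karlin's identity + Sylvester's identity) we use Ando's
  smoothing device [Ando1987, proof of Thm. 2.7]: the Gaussian matrix
  `G_σ = (e^{-σ(i-j)²})_{i,j<n}` is STRICTLY totally positive for `σ > 0` (`det_submatrix_gauss_pos`:
  `e^{-σ(i-j)²} = e^{-σi²} (e^{2σi})^j e^{-σj²}`, so consecutive-column minors are positive multiples
  of Vandermonde determinants in the increasing nodes `e^{2σ i}`, and Fekete's criterion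
  `det_submatrix_pos_of_consecutive` (FeketeCriterion.lean) does the rest). By the Cauchy–Binet
  formula (`det_mul_eq_sum_strictMono`, MultiplyPositiveProofs.lean) every minor of `G_σ A` with
  consecutive columns is `Σ_t G_σ[r|t] · A[t|c] > 0`: all terms are `≥ 0` and, `A` being
  invertible, some `A[t|c] ≠ 0` (Cauchy–Binet for `A⁻¹ A = 1`, `exists_det_submatrix_ne_zero`).
  Fekete's criterion then makes EVERY minor of `G_σ A` positive, and `G_σ A → A` entrywise as
  `σ → ∞`, so every minor of `A` is `≥ 0`.
* **Initial columns suffice for lower triangular `L`** ([FallatJohnson2011, proof of Lemma 3.3.4],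
  `det_submatrix_nonneg_of_initial`): a consecutive-column minor `L[α|β]`, `β = {j₀,…,j₀+k-1}`, is
  `0` if `α₀ < j₀` (zero first row), and otherwise
  `L[{0..j₀-1} ∪ α | {0..j₀+k-1}] = (∏_{i<j₀} L_ii) · L[α|β]` (block lower triangular), where the
  left side is an initial-column minor (`≥ 0`) and `∏_{i<j₀} L_ii > 0` (it is itself an initial
  minor, and non-zero because `det L ≠ 0`).

## Main results

* `det_submatrix_gauss_pos`, `exists_det_submatrix_ne_zero`, `det_submatrix_nonneg_of_isConsec`,
  `det_submatrix_nonneg_of_initial`.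
* `ando1987_lowerTriangular_tn_holds : ando1987_lowerTriangular_tn` (the discharge).
* `IsColumnPF.isPolyaFrequencySeq`, `IsPolyaFrequencySeq.mulLinear_neg_ratioLimit` — the
  unconditional forms of the two `_of_ando` theorems of PolyaFrequencyRecognition.lean.

## References

* T. Ando, *Totally positive matrices*, Linear Algebra Appl. 90 (1987) 165–219, Thm. 2.1,
  Cor. 2.2, Thm. 2.7. [Ando1987]
* S. M. Fallat, C. R. Johnson, *Totally Nonnegative Matrices*, Princeton UP 2011, Thm. 3.3.2,
  Lemma 3.3.4 (p. 86), Cor. 3.1.5 (Fekete). [FallatJohnson2011]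
* C. W. Cryer, *Some properties of totally positive matrices*, Linear Algebra Appl. 15 (1976)
  1–25, Thm. 1.3.
-/

noncomputable section

open Matrix Finset Filter
open scoped Topology

namespace Literature.Analysis.TotalPositivity

/-! ### A. Strict total positivity of the Gaussian matrix -/

section Gauss

variable {n : ℕ}

/-- Strictly increasing selections glued from an initial segment and a tail lying above it are
strictly increasing. [folklore] -/
theorem strictMono_fin_append {α : Type*} [Preorder α] {m k : ℕ} {a : Fin m → α} {b : Fin k → α}
    (ha : StrictMono a) (hb : StrictMono b) (hab : ∀ i j, a i < b j) :
    StrictMono (Fin.append a b) := by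
  intro x y hxy
  have hxy' := Fin.lt_def.1 hxy
  induction x using Fin.addCases with
  | left i =>
    induction y using Fin.addCases with
    | left j =>
      simp only [Fin.append_left]
      simp only [Fin.val_castAdd] at hxy'
      exact ha (Fin.lt_def.2 hxy')
    | right j =>
      simp only [Fin.append_left, Fin.append_right]
      exact hab i j
  | right i =>
    induction y using Fin.addCases with
    | left j =>
      exfalso
      simp only [Fin.val_castAdd, Fin.val_natAdd] at hxy'
      omega
    | right j =>
      simp only [Fin.append_right]
      simp only [Fin.val_natAdd] at hxy'
      exact hb (Fin.lt_def.2 (by omega))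

/-- The entries of the Gaussian matrix factor as `e^{-σ(i-j)²} = e^{-σ i²} · (e^{2σ i})^j · e^{-σ j²}`.
[Ando 1987, §2 (the kernel `e^{-σ(x-y)²}`); Karlin 1968, Ch. 3] [folklore] -/
theorem exp_neg_mul_sub_sq (σ : ℝ) (i j : ℕ) :
    Real.exp (-(σ * ((i : ℝ) - j) ^ 2)) =
      Real.exp (-(σ * (i : ℝ) ^ 2)) * Real.exp (2 * σ * i) ^ j * Real.exp (-(σ * (j : ℝ) ^ 2)) := by
  rw [← Real.exp_nat_mul, ← Real.exp_add, ← Real.exp_add]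
  congr 1
  ring

/-- **The Gaussian matrix `(e^{-σ(i-j)²})_{i,j<n}` is strictly totally positive** for `σ > 0`:
every minor with strictly increasing rows and columns is `> 0`. Consecutive-column minors are
`(∏ e^{-σ rᵢ²}) (∏ e^{-σ cⱼ²}) (∏ x_{rᵢ}^{c₀}) · V(x_{r₀}, …)` with the Vandermonde determinant `V`
in the increasing nodes `xᵢ = e^{2σ i}`, hence positive; Fekete's criterion
(`det_submatrix_pos_of_consecutive`) gives all minors. [Ando 1987, §2; Karlin 1968, Ch. 3, §1
(total positivity of `e^{-(x-y)²}`); Fallat–Johnson 2011, Cor. 3.1.5] [folklore] -/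
theorem det_submatrix_gauss_pos {σ : ℝ} (hσ : 0 < σ) {k : ℕ} (r c : Fin k → Fin n)
    (hr : StrictMono r) (hc : StrictMono c) :
    0 < ((Matrix.of fun i j : Fin n => Real.exp (-(σ * ((i : ℝ) - j) ^ 2))).submatrix r c).det := by
  set Gm : Matrix (Fin n) (Fin n) ℝ := Matrix.of fun i j : Fin n => Real.exp (-(σ * ((i : ℝ) - j) ^ 2))
    with hGm
  -- the nodes
  set x : Fin n → ℝ := fun i => Real.exp (2 * σ * (i : ℕ)) with hx
  have hxmono : StrictMono x := by
    intro i j hij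
    simp only [hx]
    refine Real.exp_lt_exp.2 ?_
    have : ((i : ℕ) : ℝ) < ((j : ℕ) : ℝ) := by exact_mod_cast hij
    nlinarith
  have hxpos : ∀ i, 0 < x i := fun i => Real.exp_pos _
  -- consecutive-column minors (any strictly increasing rows) are positive
  have hcons : ∀ (k : ℕ) (r c : Fin k → Fin n), StrictMono r → IsConsec c →
      0 < (Gm.submatrix r c).det := by
    intro k r c hr hc
    rcases k with _ | k
    · simp [Matrix.det_isEmpty]
    have hcj : ∀ j : Fin (k + 1), ((c j : ℕ) : ℕ) = (c 0 : ℕ) + j := hc.val_eq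
    -- factorisation of the minor
    have hfac : Gm.submatrix r c = Matrix.of (fun i j : Fin (k + 1) =>
        Real.exp (-(σ * ((r i : ℕ) : ℝ) ^ 2)) *
          (Matrix.of fun i j : Fin (k + 1) => (x (r i) ^ (c 0 : ℕ)) *
            (Matrix.of fun i j : Fin (k + 1) =>
              Real.exp (-(σ * ((c j : ℕ) : ℝ) ^ 2)) * Matrix.vandermonde (x ∘ r) i j) i j) i j) := by
      ext i j
      simp only [hGm, Matrix.submatrix_apply, Matrix.of_apply, Matrix.vandermonde_apply,
        Function.comp_apply, hx]
      rw [show ((r i : ℕ) : ℝ) = ((r i : ℕ) : ℕ) from rfl, exp_neg_mul_sub_sq σ (r i) (c j), hcj j,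
        pow_add]
      push_cast
      ring
    rw [hfac, Matrix.det_mul_column, Matrix.det_mul_column, Matrix.det_mul_row,
      Matrix.det_vandermonde]
    refine mul_pos (prod_pos fun i _ => Real.exp_pos _) (mul_pos (prod_pos fun i _ =>
      pow_pos (hxpos _) _) (mul_pos (prod_pos fun i _ => Real.exp_pos _) ?_))
    refine prod_pos fun i _ => prod_pos fun j hj => ?_
    rw [Finset.mem_Ioi] at hj
    exact sub_pos.2 (hxmono (hr hj))
  exact det_submatrix_pos_of_consecutive Gm (m := k)
    (fun k' _ r' c' hr' hc' => hcons k' r' c' hr'.strictMono hc') le_rfl r c hr hc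

end Gauss

/-! ### B. Cauchy–Binet: smoothing an invertible matrix -/

section Smoothing

variable {n : ℕ}

/-- **An invertible matrix has a non-zero maximal minor in any prescribed set of (distinct)
columns**: from the Cauchy–Binet expansion of `(A⁻¹ A)[c|c] = 1`. [Gantmacher 1959, Ch. I §2;
Fallat–Johnson 2011, §3.3] [folklore] -/
theorem exists_det_submatrix_ne_zero (A : Matrix (Fin n) (Fin n) ℝ) (hA : A.det ≠ 0) {k : ℕ}
    (c : Fin k → Fin n) (hc : Function.Injective c) :
    ∃ t : Fin k → Fin n, StrictMono t ∧ (A.submatrix t c).det ≠ 0 := by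
  classical
  by_contra h
  push Not at h
  have h1 : ((A⁻¹ * A).submatrix c c).det = 1 := by
    rw [Matrix.nonsing_inv_mul A (isUnit_iff_ne_zero.2 hA)]
    have : (1 : Matrix (Fin n) (Fin n) ℝ).submatrix c c = 1 := by
      ext i j
      simp [Matrix.one_apply, hc.eq_iff]
    rw [this, Matrix.det_one]
  have h2 : ((A⁻¹ * A).submatrix c c).det = 0 := by
    rw [Matrix.submatrix_mul _ _ c id c Function.bijective_id, det_mul_eq_sum_strictMono]
    refine Finset.sum_eq_zero fun t ht => ?_
    rw [Finset.mem_filter] at ht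
    have : ((A.submatrix id c).submatrix t id) = A.submatrix t c := by
      simp [Matrix.submatrix_submatrix]
    rw [this, h t ht.2, mul_zero]
  rw [h1] at h2
  exact one_ne_zero h2

/-- **Smoothing.** If `A` is invertible and all its minors with consecutive columns are `≥ 0`,
then every consecutive-column minor of `G_σ A` (`G_σ` the Gaussian matrix, `σ > 0`) is `> 0`:
Cauchy–Binet `(G_σ A)[r|c] = Σ_t G_σ[r|t] A[t|c]` with `G_σ[r|t] > 0`, `A[t|c] ≥ 0` and some
`A[t|c] ≠ 0`. [Ando 1987, proof of Thm. 2.7] [folklore] -/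
theorem det_submatrix_gauss_mul_pos {σ : ℝ} (hσ : 0 < σ) (A : Matrix (Fin n) (Fin n) ℝ)
    (hA : A.det ≠ 0)
    (h : ∀ (k : ℕ) (r c : Fin k → Fin n), StrictMono r → IsConsec c → 0 ≤ (A.submatrix r c).det)
    {k : ℕ} (r c : Fin k → Fin n) (hr : StrictMono r) (hc : IsConsec c) :
    0 < (((Matrix.of fun i j : Fin n => Real.exp (-(σ * ((i : ℝ) - j) ^ 2))) * A).submatrix
      r c).det := by
  classical
  set Gm : Matrix (Fin n) (Fin n) ℝ := Matrix.of fun i j : Fin n => Real.exp (-(σ * ((i : ℝ) - j) ^ 2))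
    with hGm
  rw [Matrix.submatrix_mul _ _ r id c Function.bijective_id, det_mul_eq_sum_strictMono]
  have hsub : ∀ t : Fin k → Fin n, ((Gm.submatrix r id).submatrix id t) = Gm.submatrix r t ∧
      ((A.submatrix id c).submatrix t id) = A.submatrix t c := fun t => by
    simp [Matrix.submatrix_submatrix]
  refine Finset.sum_pos' (fun t ht => ?_) ?_
  · rw [Finset.mem_filter] at ht
    rw [(hsub t).1, (hsub t).2]
    exact mul_nonneg (det_submatrix_gauss_pos hσ r t hr ht.2).le (h k t c ht.2 hc)
  · obtain ⟨t, ht, hne⟩ := exists_det_submatrix_ne_zero A hA c hc.strictMono.injective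
    refine ⟨t, Finset.mem_filter.2 ⟨Finset.mem_univ _, ht⟩, ?_⟩
    rw [(hsub t).1, (hsub t).2]
    exact mul_pos (det_submatrix_gauss_pos hσ r t hr ht) (lt_of_le_of_ne (h k t c ht hc) hne.symm)

/-- `G_σ A → A` entrywise as `σ → ∞` (`e^{-σ·0} = 1`, `e^{-σ d²} → 0` for `d ≠ 0`), hence so do
all minors (determinants are continuous). [folklore] -/
theorem tendsto_det_submatrix_gauss_mul (A : Matrix (Fin n) (Fin n) ℝ) {k : ℕ}
    (r c : Fin k → Fin n) :
    Tendsto (fun σ : ℝ => (((Matrix.of fun i j : Fin n =>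
      Real.exp (-(σ * ((i : ℝ) - j) ^ 2))) * A).submatrix r c).det) atTop
      (𝓝 (A.submatrix r c).det) := by
  classical
  -- entrywise convergence of the matrices
  have hmat : Tendsto (fun σ : ℝ => ((Matrix.of fun i j : Fin n =>
      Real.exp (-(σ * ((i : ℝ) - j) ^ 2))) * A).submatrix r c) atTop (𝓝 (A.submatrix r c)) := by
    refine tendsto_pi_nhds.2 fun i => tendsto_pi_nhds.2 fun j => ?_
    simp only [Matrix.submatrix_apply, Matrix.mul_apply, Matrix.of_apply]
    have hlim : ∀ l : Fin n, Tendsto (fun σ : ℝ => Real.exp (-(σ * (((r i : ℕ) : ℝ) - l) ^ 2)) * A l (c j))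
        atTop (𝓝 (if l = r i then A l (c j) else 0)) := by
      intro l
      by_cases hl : l = r i
      · subst hl
        simp
      · rw [if_neg hl]
        have hd : 0 < (((r i : ℕ) : ℝ) - l) ^ 2 := by
          have : (((r i : ℕ) : ℝ) - l) ≠ 0 := by
            rw [sub_ne_zero]
            have hne : (r i : ℕ) ≠ (l : ℕ) := fun h' => hl (Fin.ext h').symm
            exact_mod_cast hne
          positivity
        have h1 : Tendsto (fun σ : ℝ => -(σ * (((r i : ℕ) : ℝ) - l) ^ 2)) atTop atBot := by
          have := (tendsto_id (α := ℝ)).atTop_mul_const hd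
          refine (tendsto_neg_atTop_atBot.comp this).congr fun σ => ?_
          simp
        have h2 := Real.tendsto_exp_atBot.comp h1
        simpa using h2.mul_const (A l (c j))
    have := tendsto_finsetSum (Finset.univ : Finset (Fin n)) fun l _ => hlim l
    simpa using this
  exact ((continuous_id.matrix_det).tendsto _).comp hmat

/-- **Ando–Cryer recognition in full rank** ([FallatJohnson2011, Thm. 3.3.2] with `r = n`;
[Ando1987, Thm. 2.1]; Cryer 1976, Thm. 1.3): an invertible real matrix all of whose minors with
CONSECUTIVE columns (and arbitrary rows) are `≥ 0` is totally nonnegative. Proof by Gaussian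
smoothing: every minor of `G_σ A` is `> 0` (`det_submatrix_gauss_mul_pos` + Fekete's criterion),
and `G_σ A → A`. [cite: FallatJohnson2011, Thm. 3.3.2] -/
theorem det_submatrix_nonneg_of_isConsec (A : Matrix (Fin n) (Fin n) ℝ) (hA : A.det ≠ 0)
    (h : ∀ (k : ℕ) (r c : Fin k → Fin n), StrictMono r → IsConsec c → 0 ≤ (A.submatrix r c).det)
    {k : ℕ} (r c : Fin k → Fin n) (hr : StrictMono r) (hc : StrictMono c) :
    0 ≤ (A.submatrix r c).det := by
  refine ge_of_tendsto (tendsto_det_submatrix_gauss_mul A r c) ?_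
  filter_upwards [eventually_gt_atTop (0 : ℝ)] with σ hσ
  refine (det_submatrix_pos_of_consecutive (m := k) _ (fun k' _ r' c' hr' hc' => ?_) le_rfl r c
    hr hc).le
  exact det_submatrix_gauss_mul_pos hσ A hA h r' c' hr'.strictMono hc'

end Smoothing

/-! ### C. Lower triangular matrices: initial columns suffice -/

section Triangular

variable {n : ℕ}

/-- A lower triangular matrix with non-zero determinant has non-zero diagonal entries.
[folklore] -/
theorem diag_ne_zero_of_lowerTriangular (A : Matrix (Fin n) (Fin n) ℝ)
    (hlt : ∀ i j : Fin n, i < j → A i j = 0) (hA : A.det ≠ 0) (i : Fin n) : A i i ≠ 0 := by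
  have hdet : A.det = ∏ i, A i i :=
    Matrix.det_of_lowerTriangular A fun i j hij => hlt i j hij
  rw [hdet] at hA
  exact (Finset.prod_ne_zero_iff.1 hA) i (Finset.mem_univ i)

/-- **Initial-column minors control consecutive-column minors of an invertible lower triangular
matrix** ([FallatJohnson2011, proof of Lemma 3.3.4]): with `β = {j₀, …, j₀+k-1}`,
`L[α|β] = 0` if `α₀ < j₀`, and otherwise `L[{0..j₀-1} ∪ α | {0..j₀+k-1}] = (∏_{i<j₀} L_ii) L[α|β]`
with `∏_{i<j₀} L_ii > 0`. [cite: FallatJohnson2011, Lemma 3.3.4] -/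
theorem det_submatrix_nonneg_of_initial (A : Matrix (Fin n) (Fin n) ℝ)
    (hlt : ∀ i j : Fin n, i < j → A i j = 0) (hA : A.det ≠ 0)
    (hinit : ∀ (k : ℕ) (hk : k ≤ n) (r : Fin k → Fin n), StrictMono r →
      0 ≤ (A.submatrix r (Fin.castLE hk)).det)
    {k : ℕ} (r c : Fin k → Fin n) (hr : StrictMono r) (hc : IsConsec c) :
    0 ≤ (A.submatrix r c).det := by
  classical
  rcases k with _ | k
  · simp [Matrix.det_isEmpty]
  set j₀ : ℕ := (c 0 : ℕ) with hj₀
  have hcj : ∀ j : Fin (k + 1), ((c j : ℕ) : ℕ) = j₀ + j := hc.val_eq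
  by_cases h0 : (r 0 : ℕ) < j₀
  · -- the first row of the minor vanishes
    have : (A.submatrix r c).det = 0 := by
      refine Matrix.det_eq_zero_of_row_eq_zero 0 fun j => ?_
      simp only [Matrix.submatrix_apply]
      refine hlt _ _ (Fin.lt_def.2 ?_)
      have := hcj j
      omega
    rw [this]
  push Not at h0
  -- sizes
  have hkn : j₀ + (k + 1) ≤ n := by
    have h1 := hcj (Fin.last k)
    have h2 := (c (Fin.last k)).2
    simp only [Fin.val_last] at h1
    omega
  have hj₀n : j₀ ≤ n := by omega
  -- the glued selections
  set a : Fin j₀ → Fin n := Fin.castLE hj₀n with ha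
  have hamono : StrictMono a := Fin.strictMono_castLE hj₀n
  have har : ∀ i j, a i < r j := fun i j => by
    rw [Fin.lt_def]
    have h1 : (a i : ℕ) = i := rfl
    have h2 : (r 0 : ℕ) ≤ r j := hr.monotone (Fin.zero_le j)
    omega
  have hac : ∀ i j, a i < c j := fun i j => by
    rw [Fin.lt_def]
    have h1 : (a i : ℕ) = i := rfl
    have := hcj j
    omega
  set r' : Fin (j₀ + (k + 1)) → Fin n := Fin.append a r with hr'
  have hr'mono : StrictMono r' := strictMono_fin_append hamono hr har
  have hcols : (Fin.castLE hkn : Fin (j₀ + (k + 1)) → Fin n) = Fin.append a c := by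
    funext x
    induction x using Fin.addCases with
    | left i => rw [Fin.append_left]; rfl
    | right j =>
      rw [Fin.append_right]
      refine Fin.ext ?_
      simp [hcj j]
  -- the initial minor with rows `r'`
  have hbig := hinit (j₀ + (k + 1)) hkn r' hr'mono
  rw [hcols] at hbig
  -- block structure
  set e := (finSumFinEquiv (m := j₀) (n := k + 1)) with he
  have hblock : (A.submatrix r' (Fin.append a c)).submatrix e e =
      Matrix.fromBlocks (A.submatrix a a) 0 (A.submatrix r a) (A.submatrix r c) := by
    ext (i | i) (j | j)
    · simp [hr', he, Matrix.fromBlocks]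
    · simp only [hr', he, Matrix.submatrix_apply, finSumFinEquiv_apply_left,
        finSumFinEquiv_apply_right, Fin.append_left, Fin.append_right, Matrix.fromBlocks_apply₁₂,
        Matrix.zero_apply]
      exact hlt _ _ (hac i j)
    · simp [hr', he, Matrix.fromBlocks]
    · simp [hr', he, Matrix.fromBlocks]
  have hdet : (A.submatrix r' (Fin.append a c)).det = (A.submatrix a a).det * (A.submatrix r c).det := by
    rw [← Matrix.det_submatrix_equiv_self e, hblock, Matrix.det_fromBlocks_zero₁₂]
  rw [hdet] at hbig
  -- the leading block has positive determinant
  have hlead_tri : (A.submatrix a a).det = ∏ i, A (a i) (a i) := by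
    refine Matrix.det_of_lowerTriangular _ fun i j hij => ?_
    exact hlt _ _ (hamono hij)
  have hlead_ne : (A.submatrix a a).det ≠ 0 := by
    rw [hlead_tri]
    exact Finset.prod_ne_zero_iff.2 fun i _ => diag_ne_zero_of_lowerTriangular A hlt hA (a i)
  have hlead_nonneg : 0 ≤ (A.submatrix a a).det := hinit j₀ hj₀n a hamono
  have hlead_pos : 0 < (A.submatrix a a).det := lt_of_le_of_ne hlead_nonneg hlead_ne.symm
  exact nonneg_of_mul_nonneg_right hbig hlead_pos

end Triangular

/-! ### D. The discharge and its unconditional corollaries -/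

/-- **DISCHARGE of `ando1987_lowerTriangular_tn`** ([Ando1987, Cor. 2.2]; Cryer 1976;
[FallatJohnson2011, Lemma 3.3.4]): an invertible lower triangular real matrix whose minors with
initial columns `0, …, k-1` (arbitrary rows) are all `≥ 0` is totally nonnegative. Initial columns
control consecutive columns (`det_submatrix_nonneg_of_initial`), and consecutive columns control
everything for invertible matrices (`det_submatrix_nonneg_of_isConsec`).
[cite: Ando1987, Cor. 2.2] -/
theorem ando1987_lowerTriangular_tn_holds : ando1987_lowerTriangular_tn := by
  intro n A hlt hA hinit k r c hr hc
  exact det_submatrix_nonneg_of_isConsec A hA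
    (fun k r c hr hc => det_submatrix_nonneg_of_initial A hlt hA hinit r c hr hc) r c hr hc

/-- **Recognition for sequences, unconditionally**: a column-positive one-sided sequence with
`b₀ > 0` is a Pólya frequency sequence. [Ando 1987, Cor. 2.2; Fallat–Johnson 2011, Lemma 3.3.4]
[cite: Ando1987, Cor. 2.2] -/
theorem IsColumnPF.isPolyaFrequencySeq {b : ℕ → ℝ} (hb : IsColumnPF b) (h0 : 0 < b 0) :
    IsPolyaFrequencySeq b :=
  hb.isPolyaFrequencySeq_of_ando ando1987_lowerTriangular_tn_holds h0

/-- **Pole stripping preserves PF, unconditionally**: if `b` is a Pólya frequency sequence with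
all `bₙ > 0` and `ℓ = lim b_{n+1}/bₙ`, then `(bₙ - ℓ b_{n-1})ₙ` is again a Pólya frequency
sequence. [Aissen–Edrei–Schoenberg–Whitney 1951, Thm. 2; Ando 1987, Cor. 2.2]
[cite: AissenEdreiSchoenbergWhitney1951, Thm. 2] -/
theorem IsPolyaFrequencySeq.mulLinear_neg_ratioLimit {b : ℕ → ℝ} (hb : IsPolyaFrequencySeq b)
    (hpos : ∀ n, 0 < b n) :
    IsPolyaFrequencySeq (Literature.Analysis.TotalPositivity.mulLinear b (-(ratioLimit b))) :=
  hb.mulLinear_neg_of_ando ando1987_lowerTriangular_tn_holds hpos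

end Literature.Analysis.TotalPositivity
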